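import Summits.Ventures.PercRepro.C041RelaxedTriangleCone

/-!
# THEOREM (RELAXED TRIANGLE): (P) at two hanging zones implies (P) at the triangle that carries them
(mine-3, gen 59; C-041.md §21 (g)–(l), the decomposition lemma in the form of §21 (q))

THE DECOMPOSITION LEMMA (`genCone_of_rel`): every relaxed-feasible six-vector is a non-negative combination of the
generators of `C041RelaxedTriangleCone` — the apex `1`, the rays `eT1`, `eT2` and the four extreme curves.  Written on
the zone data `(F, T₁, T₂, σ, i₁, i₂)` (`sixN`), the coefficient of `1` is forced (`I_F = F − σ − i₁ − i₂`, the only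
generator with an invalid state without type), and the rest is one of four explicit identities: `σ = 0`
(`sixN_eq_zero_case`: the two corner points `sixF2m 0`, `sixF2 0` and the rays); `i₁ i₂ ≥ σ²` (`sixN_eq_caseA`: the F3
point with `T₁ = i₁`, `T₂ = σ²/i₁` and the corner point `sixF2 0`); `i₁ i₂ ≤ σ² ≤ i₁ T₂` (`sixN_eq_caseB1`: the F2′ and
F3 points at `(i₁, σ²/i₁, σ)` with weights `1 − b`, `b = i₁ i₂/σ²`); `i₁ T₂ ≤ σ²` (`sixN_eq_caseB2`: the four curve points
at `(σ²/T₂, T₂, σ)` with the product weights `(1 − a)(1 − b)`, `(1 − a) b`, `a b`, `a (1 − b)`, `a = i₁ T₂/σ²`,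
`b = i₂/T₂`).  No square root, no minimum: the case split replaces the interval of §21 (k)(3)–(4).

THEOREM (`K4v_thetaTri_of_rel`): `Rel w → Rel w′ → K4v (thetaTri w w′)` — (P), hence the one-anchor (CS) and the
ZONE O-CUBE (`zoneOCube_thetaTri_of_rel`), at the triangle with ANY two relaxed-feasible zones.  COROLLARY
(`K4v_thetaTri_of_InCone`): cone members are relaxed-feasible (`Rel_of_InCone`: the trivial bounds are preserved by
products, sums and scaling), so the triangle with two cone inputs satisfies (P) — the input of THEOREM (CYCLES WITH
TWO MARKED VERTICES), C-041.md §21 (m).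
-/

namespace PercRepro

namespace RelaxedTriangle

open TreeClosure

/-! ## The decomposition lemma -/

/-- Every six-vector is `sixN` of its own zone data `(F, T₁, T₂, σ, i₁, i₂)`. -/
theorem sixN_self (w : Vec6) :
    sixN (w 0) (w 1 - w 0) (w 2 - w 0) (w 0 - (w 4 + w 5 - w 3)) (w 4 - w 3) (w 5 - w 3) = w := by
  ext i
  simp only [sixN]
  fin_cases i <;> simp

/-- CASE `σ = 0`: the corner points `sixF2m 0 = (1, 2, 1, 0, 1, 0)` and `sixF2 0 = (1, 1, 2, 0, 0, 1)` carry the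
invalid type states, the rays the valid ones. -/
theorem sixN_eq_zero_case (F T1 T2 i1 i2 : ℝ) :
    sixN F T1 T2 0 i1 i2 = (F - 0 - i1 - i2) • (1 : Vec6) + i1 • sixF2m 0 + i2 • sixF2 0
      + (T1 - i1) • eT1 + (T2 - i2) • eT2 := by
  ext i
  simp only [Pi.add_apply, Pi.smul_apply, Pi.one_apply, smul_eq_mul, sixN, sixF2m, sixF2, eT1, eT2]
  fin_cases i <;> simp <;> ring

/-- CASE A, `i₁ i₂ ≥ σ²`: the F3 point with `(T₁, T₂, σ) = (i₁, σ²/i₁, σ)` plus `(i₂ − σ²/i₁)` corner points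
`sixF2 0` plus the rays. -/
theorem sixN_eq_caseA (F T1 T2 s i1 i2 : ℝ) (hs : s ≠ 0) (hi1 : i1 ≠ 0) :
    sixN F T1 T2 s i1 i2 = (F - s - i1 - i2) • (1 : Vec6) + (s ^ 2 / i1) • sixF3 (i1 / s)
      + (i2 - s ^ 2 / i1) • sixF2 0 + (T1 - i1) • eT1 + (T2 - i2) • eT2 := by
  ext i
  simp only [Pi.add_apply, Pi.smul_apply, Pi.one_apply, smul_eq_mul, sixN, sixF3, sixF2, eT1, eT2]
  fin_cases i <;> simp [-mul_eq_zero, -div_eq_zero_iff] <;> first | ring1 | (field_simp; ring1)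

/-- CASE B1, `i₁ i₂ ≤ σ² ≤ i₁ T₂`: the F2′ and F3 points with `(T₁, T₂, σ) = (i₁, σ²/i₁, σ)`, weights `1 − b` and
`b = i₁ i₂/σ²`, plus the rays. -/
theorem sixN_eq_caseB1 (F T1 T2 s i1 i2 : ℝ) (hs : s ≠ 0) (hi1 : i1 ≠ 0) :
    sixN F T1 T2 s i1 i2 = (F - s - i1 - i2) • (1 : Vec6) + (1 - i1 * i2 / s ^ 2) • (i1 • sixF2m (s / i1))
      + (i1 * i2 / s ^ 2) • ((s ^ 2 / i1) • sixF3 (i1 / s)) + (T1 - i1) • eT1 + (T2 - s ^ 2 / i1) • eT2 := by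
  ext i
  simp only [Pi.add_apply, Pi.smul_apply, Pi.one_apply, smul_eq_mul, sixN, sixF3, sixF2m, eT1, eT2]
  fin_cases i <;> simp [-mul_eq_zero, -div_eq_zero_iff] <;> first | ring1 | (field_simp; ring1)

/-- CASE B2, `i₁ T₂ ≤ σ²`: the four curve points with `(T₁, T₂, σ) = (σ²/T₂, T₂, σ)` and the product weights
`(1 − a)(1 − b)`, `(1 − a) b`, `a b`, `a (1 − b)` (`a = i₁ T₂/σ²`, `b = i₂/T₂`), plus the ray `e_{T₁}`. -/
theorem sixN_eq_caseB2 (F T1 T2 s i1 i2 : ℝ) (hs : s ≠ 0) (hT2 : T2 ≠ 0) :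
    sixN F T1 T2 s i1 i2 = (F - s - i1 - i2) • (1 : Vec6)
      + ((1 - i1 * T2 / s ^ 2) * (1 - i2 / T2)) • (T2 • sixF1 (s / T2))
      + ((1 - i1 * T2 / s ^ 2) * (i2 / T2)) • (T2 • sixF2 (s / T2))
      + ((i1 * T2 / s ^ 2) * (i2 / T2)) • (T2 • sixF3 (s / T2))
      + ((i1 * T2 / s ^ 2) * (1 - i2 / T2)) • ((s ^ 2 / T2) • sixF2m (T2 / s))
      + (T1 - s ^ 2 / T2) • eT1 := by
  ext i
  simp only [Pi.add_apply, Pi.smul_apply, Pi.one_apply, smul_eq_mul, sixN, sixF1, sixF2, sixF2m, sixF3, eT1]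
  fin_cases i <;> simp [-mul_eq_zero, -div_eq_zero_iff] <;> first | ring1 | (field_simp; ring1)

/-- **LEMMA (DECOMPOSITION)**, on zone data: a relaxed-feasible `(F, T₁, T₂, σ, i₁, i₂)` — `σ² ≤ T₁T₂`, `0 ≤ σ`,
`0 ≤ i₁ ≤ T₁`, `0 ≤ i₂ ≤ T₂`, `0 ≤ I_F = F − σ − i₁ − i₂` — lies in the generator cone. -/
theorem genCone_sixN (F T1 T2 s i1 i2 : ℝ) (hT2 : 0 ≤ T2) (hs : 0 ≤ s) (hcs : s ^ 2 ≤ T1 * T2)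
    (hi1 : 0 ≤ i1) (hi1T : i1 ≤ T1) (hi2 : 0 ≤ i2) (hi2T : i2 ≤ T2) (hF : 0 ≤ F - s - i1 - i2) :
    GenCone (sixN F T1 T2 s i1 i2) := by
  rcases eq_or_lt_of_le hs with hs0 | hspos
  · subst hs0
    rw [sixN_eq_zero_case]
    exact ((((GenCone.smul _ hF (.base .one)).add (GenCone.smul _ hi1 (.base (.f2m 0 le_rfl)))).add
      (GenCone.smul _ hi2 (.base (.f2 0 le_rfl)))).add (GenCone.smul _ (by linarith) (.base .rayT1))).add
      (GenCone.smul _ (by linarith) (.base .rayT2))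
  · have hsne : s ≠ 0 := hspos.ne'
    have hs2 : 0 < s ^ 2 := by positivity
    rcases le_or_gt (s ^ 2) (i1 * i2) with hA | hB
    · -- CASE A
      have hi1pos : 0 < i1 := by
        rcases eq_or_lt_of_le hi1 with h | h
        · rw [← h] at hA
          nlinarith
        · exact h
      rw [sixN_eq_caseA F T1 T2 s i1 i2 hsne hi1pos.ne']
      refine ((((GenCone.smul _ hF (.base .one)).add
        (GenCone.smul _ (by positivity) (.base (.f3 _ (by positivity))))).add
        (GenCone.smul _ ?_ (.base (.f2 0 le_rfl)))).add (GenCone.smul _ (by linarith) (.base .rayT1))).add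
        (GenCone.smul _ (by linarith) (.base .rayT2))
      rw [sub_nonneg, div_le_iff₀ hi1pos]
      linarith
    · rcases le_or_gt (s ^ 2) (i1 * T2) with hB1 | hB2
      · -- CASE B1
        have hi1pos : 0 < i1 := by
          rcases eq_or_lt_of_le hi1 with h | h
          · rw [← h] at hB1
            nlinarith
          · exact h
        rw [sixN_eq_caseB1 F T1 T2 s i1 i2 hsne hi1pos.ne']
        refine ((((GenCone.smul _ hF (.base .one)).add
          (GenCone.smul _ ?_ (GenCone.smul _ hi1 (.base (.f2m _ (by positivity)))))).add
          (GenCone.smul _ (by positivity) (GenCone.smul _ (by positivity) (.base (.f3 _ (by positivity)))))).add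
          (GenCone.smul _ (by linarith) (.base .rayT1))).add (GenCone.smul _ ?_ (.base .rayT2))
        · rw [sub_nonneg, div_le_one hs2]
          exact hB.le
        · rw [sub_nonneg, div_le_iff₀ hi1pos]
          linarith
      · -- CASE B2
        have hT2pos : 0 < T2 := by
          rcases eq_or_lt_of_le hT2 with h | h
          · rw [← h] at hcs
            nlinarith
          · exact h
        rw [sixN_eq_caseB2 F T1 T2 s i1 i2 hsne hT2pos.ne']
        have ha : i1 * T2 / s ^ 2 ≤ 1 := by
          rw [div_le_one hs2]
          exact hB2.le
        have ha0 : 0 ≤ i1 * T2 / s ^ 2 := by positivity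
        have hb : i2 / T2 ≤ 1 := by
          rw [div_le_one hT2pos]
          exact hi2T
        have hb0 : 0 ≤ i2 / T2 := by positivity
        refine (((((GenCone.smul _ hF (.base .one)).add
          (GenCone.smul _ (mul_nonneg (by linarith) (by linarith))
            (GenCone.smul _ hT2 (.base (.f1 _ (by positivity)))))).add
          (GenCone.smul _ (mul_nonneg (by linarith) hb0) (GenCone.smul _ hT2 (.base (.f2 _ (by positivity)))))).add
          (GenCone.smul _ (mul_nonneg ha0 hb0) (GenCone.smul _ hT2 (.base (.f3 _ (by positivity)))))).add
          (GenCone.smul _ (mul_nonneg ha0 (by linarith))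
            (GenCone.smul _ (by positivity) (.base (.f2m _ (by positivity)))))).add
          (GenCone.smul _ ?_ (.base .rayT1))
        rw [sub_nonneg, div_le_iff₀ hT2pos]
        linarith

/-- **LEMMA (DECOMPOSITION)**: every relaxed-feasible six-vector lies in the generator cone. -/
theorem genCone_of_rel {w : Vec6} (hw : Rel w) : GenCone w := by
  obtain ⟨hk, h3, h4, h5, h6, h7⟩ := hw
  obtain ⟨_, k2, _, k4, k5⟩ := hk
  rw [← sixN_self w]
  exact genCone_sixN _ _ _ _ _ _ k2 (by linarith) k5 h4 h5 h6 h7 (by linarith)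

/-! ## THEOREM (RELAXED TRIANGLE) -/

/-- **THEOREM (RELAXED TRIANGLE)**: if the two hanging zones `w`, `w′` satisfy (P) and the trivial bounds, the
triangle `a – u – u′ – a` carrying them satisfies (P): `(F − I)² ≤ T₁ T₂` and `0 ≤ I ≤ F` at the output. -/
theorem K4v_thetaTri_of_rel {w w' : Vec6} (hw : Rel w) (hw' : Rel w') : K4v (thetaTri w w') :=
  K4v_thetaTri_of_genCone (genCone_of_rel hw) (genCone_of_rel hw')

/-- The ZONE O-CUBE at the output of the relaxed triangle: `2F ≤ T₁ + T₂ + 2I`. -/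
theorem zoneOCube_thetaTri_of_rel {w w' : Vec6} (hw : Rel w) (hw' : Rel w') :
    0 ≤ (thetaTri w w' 1 - thetaTri w w' 0) + (thetaTri w w' 2 - thetaTri w w' 0)
      + 2 * (thetaTri w w' 4 + thetaTri w w' 5 - thetaTri w w' 3) - 2 * thetaTri w w' 0 :=
  zoneOCube_nonneg_of_K4 (K4v_thetaTri_of_rel hw hw')

/-! ## Cone members are relaxed-feasible -/

/-- The trivial bounds of a zone: `0 ≤ I_F ≤ F`, `0 ≤ I₁ ≤ T₁`, `0 ≤ I₂ ≤ T₂`. -/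
structure Triv (w : Vec6) : Prop where
  iF_nonneg : 0 ≤ w 3
  iF_le : w 3 ≤ w 0
  i1_nonneg : 0 ≤ w 4 - w 3
  i1_le : w 4 - w 3 ≤ w 1 - w 0
  i2_nonneg : 0 ≤ w 5 - w 3
  i2_le : w 5 - w 3 ≤ w 2 - w 0

/-- The trivial bounds are preserved by the pointwise product (the states of a product zone are pairs of states). -/
theorem Triv.mul {x y : Vec6} (hx : Triv x) (hy : Triv y) : Triv (x * y) := by
  obtain ⟨a1, a2, a3, a4, a5, a6⟩ := hx
  obtain ⟨b1, b2, b3, b4, b5, b6⟩ := hy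
  have hx0 : 0 ≤ x 0 := le_trans a1 a2
  have hy0 : 0 ≤ y 0 := le_trans b1 b2
  have ht1' : 0 ≤ y 1 - y 0 := le_trans b3 b4
  have ht2' : 0 ≤ y 2 - y 0 := le_trans b5 b6
  refine ⟨?_, ?_, ?_, ?_, ?_, ?_⟩ <;> simp only [Pi.mul_apply]
  · exact mul_nonneg a1 b1
  · nlinarith [mul_nonneg (sub_nonneg.2 a2) b1, mul_nonneg hx0 (sub_nonneg.2 b2)]
  · nlinarith [mul_nonneg a1 b3, mul_nonneg a3 b1, mul_nonneg a3 b3]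
  · nlinarith [mul_nonneg (sub_nonneg.2 a2) ht1', mul_nonneg a1 (sub_nonneg.2 b4), mul_nonneg (sub_nonneg.2 a4) hy0,
      mul_nonneg a3 (sub_nonneg.2 b2), mul_nonneg (sub_nonneg.2 a4) ht1', mul_nonneg a3 (sub_nonneg.2 b4)]
  · nlinarith [mul_nonneg a1 b5, mul_nonneg a5 b1, mul_nonneg a5 b5]
  · nlinarith [mul_nonneg (sub_nonneg.2 a2) ht2', mul_nonneg a1 (sub_nonneg.2 b6), mul_nonneg (sub_nonneg.2 a6) hy0,
      mul_nonneg a5 (sub_nonneg.2 b2), mul_nonneg (sub_nonneg.2 a6) ht2', mul_nonneg a5 (sub_nonneg.2 b6)]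

/-- The constant vector `1` satisfies the trivial bounds. -/
theorem Triv_one : Triv (1 : Vec6) := by
  refine ⟨?_, ?_, ?_, ?_, ?_, ?_⟩ <;> simp

/-- A generator `v a`, `a ∈ [0, 1]`, satisfies the trivial bounds (its type states are all invalid). -/
theorem Triv_v (a : ℝ) (ha : 0 ≤ a ∧ a ≤ 1) : Triv (v a) := by
  obtain ⟨h0, h1⟩ := ha
  refine ⟨?_, ?_, ?_, ?_, ?_, ?_⟩ <;> simp [v] <;>
    nlinarith [mul_nonneg h0 (sub_nonneg.2 h1), sq_nonneg a, sq_nonneg (1 - a)]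

/-- A pure root `V a` satisfies the trivial bounds. -/
theorem Triv_V {m : ℕ} (a : Fin m → ℝ) (ha : ∀ i, 0 ≤ a i ∧ a i ≤ 1) : Triv (V a) := by
  unfold V
  exact Finset.prod_induction _ Triv (fun _ _ hx hy => hx.mul hy) Triv_one (fun i _ => Triv_v (a i) (ha i))

/-- The trivial bounds are preserved by sums. -/
theorem Triv_add {x y : Vec6} (hx : Triv x) (hy : Triv y) : Triv (x + y) := by
  obtain ⟨a1, a2, a3, a4, a5, a6⟩ := hx
  obtain ⟨b1, b2, b3, b4, b5, b6⟩ := hy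
  refine ⟨?_, ?_, ?_, ?_, ?_, ?_⟩ <;> simp only [Pi.add_apply] <;> linarith

/-- The trivial bounds are preserved by non-negative scaling. -/
theorem Triv_smul {x : Vec6} (hx : Triv x) {c : ℝ} (hc : 0 ≤ c) : Triv (c • x) := by
  obtain ⟨a1, a2, a3, a4, a5, a6⟩ := hx
  refine ⟨?_, ?_, ?_, ?_, ?_, ?_⟩ <;> simp only [Pi.smul_apply, smul_eq_mul] <;>
    nlinarith [mul_nonneg hc a1, mul_nonneg hc (sub_nonneg.2 a2), mul_nonneg hc a3, mul_nonneg hc (sub_nonneg.2 a4),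
      mul_nonneg hc a5, mul_nonneg hc (sub_nonneg.2 a6)]

/-- Every cone member satisfies the trivial bounds. -/
theorem Triv_of_InCone {w : Vec6} (h : InCone w) : Triv w := by
  induction h with
  | pure a ha => exact Triv_V a ha
  | add _ _ ihx ihy => exact Triv_add ihx ihy
  | smul c hc _ ih => exact Triv_smul ih hc

/-- Every cone member is relaxed-feasible. -/
theorem Rel_of_InCone {w : Vec6} (h : InCone w) : Rel w :=
  let t := Triv_of_InCone h
  ⟨K4v_of_InCone h, t.iF_nonneg, t.i1_nonneg, t.i1_le, t.i2_nonneg, t.i2_le⟩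

/-- **COROLLARY (TRIANGLE, cone inputs)**: the triangle with two cone members at its exits satisfies (P) — the
single-vertex atoms `X(p, q)`, stars, trees, one-marked-vertex zones, the class 𝒵 (C-041.md §21 (m)). -/
theorem K4v_thetaTri_of_InCone {w w' : Vec6} (hw : InCone w) (hw' : InCone w') : K4v (thetaTri w w') :=
  K4v_thetaTri_of_rel (Rel_of_InCone hw) (Rel_of_InCone hw')

/-- The ZONE O-CUBE at the output of the triangle with two cone inputs. -/
theorem zoneOCube_thetaTri_of_InCone {w w' : Vec6} (hw : InCone w) (hw' : InCone w') :
    0 ≤ (thetaTri w w' 1 - thetaTri w w' 0) + (thetaTri w w' 2 - thetaTri w w' 0)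
      + 2 * (thetaTri w w' 4 + thetaTri w w' 5 - thetaTri w w' 3) - 2 * thetaTri w w' 0 :=
  zoneOCube_nonneg_of_K4 (K4v_thetaTri_of_InCone hw hw')

end RelaxedTriangle

end PercRepro
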